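import Mathlib
import HarnessLib
import Summits.HubbardSuperconductivity.HubbardSuperconductivity.Theorems.KLProgrammePerturbedFermiCurveCausticFrame
import Summits.HubbardSuperconductivity.HubbardSuperconductivity.Theorems.KLProgrammeKLRegimeTwoPointLimitShellCountCooper
import Summits.HubbardSuperconductivity.HubbardSuperconductivity.Theorems.KLProgrammeKLRegimeTwoPointLimitShellSecondOrder

/-!
# Route `KLProgramme` — ENGINE child (stmt-HubbardSuperconductivity-20437 `KLRegimeEngineV17F2`): the CAUSTIC WINDOW of the two-shell bound on the frame's
# Fermi curve — `G″` along the translated curve, angular separation, and the square-root cap (step (T2)-caustic; design note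
# HOME/hubbard-kl-k3c2-p2/TWO-SHELL-FRAME-PORT.md §6–§8)

Cell `gate-hubbard-kl`, seat hubbard-kl-k3c2-p2 g15.  Frame twin of p1b's `klsg_window_volume_le` (`…ShellAngularCaustic`), with p1b's explicit-band convexity
replaced by `caustic_second_variation_frame_ge` (`…CausticFrame`):
* §1 the translated level `G(θ) = e_K(toLp(p(θ) − w⃗))` of a `C²` polar curve and its two derivatives in `Momentum` form
  (`hasDerivAt_toLp_curve`, `hasDerivAt_toLp_velocity`, `hasDerivAt_frameLevel_transCurve`, `hasDerivAt_fderiv_frameLevel_transCurve`: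
  `G′ = De_K(Q)[V]`, `G″ = D²e_K(Q)[V,V] + De_K(Q)[A]`);
* §2 on the frame's Fermi curve: angles of `ρ`-close curve points are `πρ/(√2 u_min)`-close mod `2π` (`exists_int_near_of_close_frame`, chord bound), the curve is
  `S_E`-Lipschitz (`abs_curve_sub_le_frame`), and the UNIFORM window convexity `G″ ≥ c(ρ)` with
  `c(ρ) = 2w·u_min² − ((w + Kc)(2Kc S_E ρ/g₀)² + 4Kc S_E·(2Kc S_E ρ/g₀)·… ) ` spelled out (`transCurve_second_deriv_ge_on_window`);
* §3 **`window_volume_le_frame`** — for a lattice vector `m`, `δ > 0`: the points of a period with `|E(p(θ) − w⃗) − ν| ≤ δ` and `2p(θ) − w⃗` within `ρ₂` of `2πm` have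
  measure `≤ 3·6√(δ/c)` (three windows of half-width `W = πρ₂/(√2 u_min)` around one such point, each `c`-convex; `klsc_volume_sublevel_le_of_convex_sqrt`).
Everything is PROVED; no definitions, no named facts; nothing asserts any stub or superconductivity.
References: DECOMP App. E Lemma E.3; FST II Lemma 2.1 [cite: FeldmanSalmhoferTrubowitz1998]; BGM 2006 §2.4, §2.7 [cite: BenfattoGiulianiMastropietro2006].
-/

noncomputable section

namespace Summit.HubbardSuperconductivity.HubbardSuperconductivity.Theorems.PerturbedFermiCurve

set_option linter.dupNamespace false -- summit = problem name (single-conjunct summit), D-0017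

open Real Set MeasureTheory
open scoped ENNReal
open Literature.MathematicalPhysics.QuantumLattice Literature.MathematicalPhysics.QuantumLattice.BandSectorCounting
open Literature.MathematicalPhysics.QuantumLattice.FermiRG
open Summit.HubbardSuperconductivity.HubbardSuperconductivity.Theorems.DispersionFlow
open Summit.HubbardSuperconductivity.HubbardSuperconductivity.Theorems.KLRegimeSplit

/-! ## §1 The translated level along a `C²` polar curve, in `Momentum` form -/

/-- The translated polar curve `θ ↦ toLp(u(θ)dir θ − w⃗)` has velocity `toLp(X_E′, Y_E′)`. [folklore] -/
theorem hasDerivAt_toLp_curve {u : ℝ → ℝ} {θ : ℝ} (hu : DifferentiableAt ℝ u θ) (wv : Fin 2 → ℝ) :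
    HasDerivAt (fun t : ℝ => (WithLp.toLp 2 (u t • dir t - wv) : Momentum)) (WithLp.toLp 2 ![VXE u θ, VYE u θ]) θ := by
  set T : (Fin 2 → ℝ) →L[ℝ] Momentum := ((EuclideanSpace.equiv (Fin 2) ℝ).symm : (Fin 2 → ℝ) →L[ℝ] Momentum) with hT
  have hcurve : HasDerivAt (fun t : ℝ => u t • dir t - wv) ![VXE u θ, VYE u θ] θ := (hasDerivAt_smul_dir_curve hu).sub_const wv
  exact T.hasFDerivAt.comp_hasDerivAt θ hcurve

/-- The velocity `θ ↦ toLp(X_E′, Y_E′)` has derivative `toLp a` (`a` the acceleration vector of `hasDerivAt_velocity`). [folklore] -/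
theorem hasDerivAt_toLp_velocity {u : ℝ → ℝ} {θ : ℝ} (hu : DifferentiableAt ℝ u θ) (hu' : DifferentiableAt ℝ (deriv u) θ) :
    HasDerivAt (fun t : ℝ => (WithLp.toLp 2 ![VXE u t, VYE u t] : Momentum))
      (WithLp.toLp 2 ![deriv (deriv u) θ * Real.cos θ - 2 * deriv u θ * Real.sin θ - u θ * Real.cos θ,
        deriv (deriv u) θ * Real.sin θ + 2 * deriv u θ * Real.cos θ - u θ * Real.sin θ]) θ := by
  set T : (Fin 2 → ℝ) →L[ℝ] Momentum := ((EuclideanSpace.equiv (Fin 2) ℝ).symm : (Fin 2 → ℝ) →L[ℝ] Momentum) with hT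
  exact T.hasFDerivAt.comp_hasDerivAt θ (hasDerivAt_velocity hu hu')

/-- **`G′ = De_K(Q)[V]`**: the frame band along the translated curve. [folklore] -/
theorem hasDerivAt_frameLevel_transCurve (μ : ℝ) (K : TrigPolyC4v) {u : ℝ → ℝ} {θ : ℝ} (hu : DifferentiableAt ℝ u θ) (wv : Fin 2 → ℝ) :
    HasDerivAt (fun t : ℝ => frameLevel μ K (WithLp.toLp 2 (u t • dir t - wv)))
      (fderiv ℝ (frameLevel μ K) (WithLp.toLp 2 (u θ • dir θ - wv)) (WithLp.toLp 2 ![VXE u θ, VYE u θ])) θ := by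
  have hcd : ContDiff ℝ 2 (frameLevel μ K) := by
    rw [frameLevel_eq_add]; exact (klfs_contDiff_e μ).add (contDiff_frameShift K)
  exact ((hcd.differentiable (by norm_num)) _).hasFDerivAt.comp_hasDerivAt θ (hasDerivAt_toLp_curve hu wv)

/-- **`G″ = D²e_K(Q)[V,V] + De_K(Q)[A]`**: the derivative of `G′` along the translated curve (`u ∈ C²`). [folklore] -/
theorem hasDerivAt_fderiv_frameLevel_transCurve (μ : ℝ) (K : TrigPolyC4v) {u : ℝ → ℝ} {θ : ℝ} (hu : DifferentiableAt ℝ u θ)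
    (hu' : DifferentiableAt ℝ (deriv u) θ) (wv : Fin 2 → ℝ) :
    HasDerivAt (fun t : ℝ => fderiv ℝ (frameLevel μ K) (WithLp.toLp 2 (u t • dir t - wv)) (WithLp.toLp 2 ![VXE u t, VYE u t]))
      (fderiv ℝ (fderiv ℝ (frameLevel μ K)) (WithLp.toLp 2 (u θ • dir θ - wv)) (WithLp.toLp 2 ![VXE u θ, VYE u θ])
          (WithLp.toLp 2 ![VXE u θ, VYE u θ]) +
        fderiv ℝ (frameLevel μ K) (WithLp.toLp 2 (u θ • dir θ - wv))
          (WithLp.toLp 2 ![deriv (deriv u) θ * Real.cos θ - 2 * deriv u θ * Real.sin θ - u θ * Real.cos θ,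
            deriv (deriv u) θ * Real.sin θ + 2 * deriv u θ * Real.cos θ - u θ * Real.sin θ])) θ := by
  have hcd : ContDiff ℝ 2 (frameLevel μ K) := by
    rw [frameLevel_eq_add]; exact (klfs_contDiff_e μ).add (contDiff_frameShift K)
  have hd2 : ContDiff ℝ 1 (fderiv ℝ (frameLevel μ K)) := hcd.fderiv_right (by norm_num)
  have hc : HasDerivAt (fun t : ℝ => fderiv ℝ (frameLevel μ K) (WithLp.toLp 2 (u t • dir t - wv)))
      (fderiv ℝ (fderiv ℝ (frameLevel μ K)) (WithLp.toLp 2 (u θ • dir θ - wv)) (WithLp.toLp 2 ![VXE u θ, VYE u θ])) θ :=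
    ((hd2.differentiable one_ne_zero) _).hasFDerivAt.comp_hasDerivAt θ (hasDerivAt_toLp_curve hu wv)
  exact hc.clm_apply (hasDerivAt_toLp_velocity hu hu')

/-! ## §2 On the frame's Fermi curve: angular separation, Lipschitz, uniform window convexity -/

section Root

variable {a b : ℝ} (B : BandBounds a b) {K : TrigPolyC4v} {κ₀ κ₁ ν : ℝ}
  (hδ : ∀ k : Fin 2 → ℝ, (∀ i, |k i| ≤ π) → |(fun k : Fin 2 → ℝ => -K.eval k) k| ≤ κ₀) (hlo : a ≤ ν - κ₀) (hhi : ν + κ₀ ≤ b)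
  (hκ : ∀ k : Fin 2 → ℝ, (∀ i, |k i| ≤ π) → ‖fderiv ℝ (fun k : Fin 2 → ℝ => -K.eval k) k‖ ≤ κ₁) (hκ₁ : κ₁ < B.Dtmin)
  {u : ℝ → ℝ} (hu : ∀ θ, IsBandFermiRadius (ν - (fun k : Fin 2 → ℝ => -K.eval k) (u θ • dir θ)) θ (u θ))
include B hδ hlo hhi hu

/-- **Angles of `ρ`-close curve points are close mod `2π`**: if `|p(θ)ᵢ − p(ζ)ᵢ| ≤ ρ` (`i = 0, 1`) then `|θ − ζ − 2πk| ≤ πρ/(√2 u_min)` for some `k ∈ ℤ`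
(chord bound `4u_min² sin²((θ−ζ)/2) ≤ |p(θ) − p(ζ)|²` and Jordan). Frame twin of `klsd_exists_int_near_of_close`. [folklore] -/
theorem exists_int_near_of_close_frame {θ ζ ρ : ℝ} (h : ∀ i : Fin 2, |(u θ • dir θ) i - (u ζ • dir ζ) i| ≤ ρ) :
    ∃ k : ℤ, |θ - ζ - k * (2 * π)| ≤ π * (ρ / (Real.sqrt 2 * B.umin)) := by
  have hup := B.umin_pos
  have hu1 : B.umin ≤ u θ := umin_le_of_shifted B hδ hlo hhi (hu θ)
  have hu2 : B.umin ≤ u ζ := umin_le_of_shifted B hδ hlo hhi (hu ζ)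
  have hX : |u θ * Real.cos θ - u ζ * Real.cos ζ| ≤ ρ := by have := h 0; simpa [dir] using this
  have hY : |u θ * Real.sin θ - u ζ * Real.sin ζ| ≤ ρ := by have := h 1; simpa [dir] using this
  have hρ0 : 0 ≤ ρ := (abs_nonneg _).trans hX
  -- chord bound
  have hcos : Real.cos (θ - ζ) = 1 - 2 * Real.sin ((θ - ζ) / 2) ^ 2 := by
    have := Real.cos_two_mul_eq_one_sub ((θ - ζ) / 2)
    rwa [show 2 * ((θ - ζ) / 2) = θ - ζ by ring] at this
  have hid : (u θ * Real.cos θ - u ζ * Real.cos ζ) ^ 2 + (u θ * Real.sin θ - u ζ * Real.sin ζ) ^ 2 =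
      (u θ - u ζ) ^ 2 + 4 * (u θ * u ζ) * Real.sin ((θ - ζ) / 2) ^ 2 := by
    have h3 := Real.cos_sub θ ζ
    have e1 := Real.sin_sq_add_cos_sq θ; have e2 := Real.sin_sq_add_cos_sq ζ
    linear_combination (u θ) ^ 2 * e1 + (u ζ) ^ 2 * e2 + 2 * u θ * u ζ * h3 - 2 * u θ * u ζ * hcos
  have hprod : B.umin ^ 2 ≤ u θ * u ζ := by rw [sq]; exact mul_le_mul hu1 hu2 hup.le (hup.le.trans hu1)
  have hs2 : 0 ≤ Real.sin ((θ - ζ) / 2) ^ 2 := sq_nonneg _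
  have hX2 : (u θ * Real.cos θ - u ζ * Real.cos ζ) ^ 2 ≤ ρ ^ 2 := by rw [← sq_abs]; exact pow_le_pow_left₀ (abs_nonneg _) hX 2
  have hY2 : (u θ * Real.sin θ - u ζ * Real.sin ζ) ^ 2 ≤ ρ ^ 2 := by rw [← sq_abs]; exact pow_le_pow_left₀ (abs_nonneg _) hY 2
  have hchord : 4 * B.umin ^ 2 * Real.sin ((θ - ζ) / 2) ^ 2 ≤ 2 * ρ ^ 2 := by
    have h4 : 4 * (u θ * u ζ) * Real.sin ((θ - ζ) / 2) ^ 2 ≤ 2 * ρ ^ 2 := by nlinarith [sq_nonneg (u θ - u ζ)]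
    nlinarith [mul_le_mul_of_nonneg_right hprod hs2]
  have hsin2 : Real.sin ((θ - ζ) / 2) ^ 2 ≤ (ρ / (Real.sqrt 2 * B.umin)) ^ 2 := by
    rw [div_pow, mul_pow, Real.sq_sqrt (by norm_num : (0:ℝ) ≤ 2), le_div_iff₀ (by positivity)]
    nlinarith
  have hsin : |Real.sin ((θ - ζ) / 2)| ≤ ρ / (Real.sqrt 2 * B.umin) := by
    have h0 : 0 ≤ ρ / (Real.sqrt 2 * B.umin) := by positivity
    rw [← sq_abs] at hsin2
    exact (pow_le_pow_iff_left₀ (abs_nonneg _) h0 two_ne_zero).1 hsin2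
  obtain ⟨k, hk⟩ := klcc_exists_int_abs_sub_mul_pi_le ((θ - ζ) / 2)
  refine ⟨k, ?_⟩
  have e : θ - ζ - k * (2 * π) = 2 * ((θ - ζ) / 2 - k * π) := by ring
  rw [e, abs_mul, abs_two]
  have := mul_le_mul_of_nonneg_left hsin (by positivity : (0:ℝ) ≤ π / 2)
  nlinarith [hk, this, Real.pi_pos]

include hκ hκ₁

/-- **The frame curve is `S_E`-Lipschitz in each coordinate**: `|p(x)ᵢ − p(y)ᵢ| ≤ S_E|x − y|` (speed bound `abs_VXE_le`). [folklore] -/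
theorem abs_curve_sub_le_frame (x y : ℝ) (i : Fin 2) :
    |(u x • dir x) i - (u y • dir y) i| ≤ (B.smax + κ₁ * (π * Real.sqrt 2 + 2 * B.smax) / (B.Dtmin - κ₁)) * |x - y| := by
  have hδs : ContDiff ℝ 2 (fun k : Fin 2 → ℝ => -K.eval k) := contDiff_frameShift_toLp K
  have h2ne : (2 : WithTop ℕ∞) ≠ 0 := by norm_num
  have hud : Differentiable ℝ u := (contDiff_of_isRoot B hδs h2ne hδ hlo hhi hκ hκ₁ hu).differentiable h2ne
  have hb := fun z => abs_VXE_le B hδs h2ne hδ hlo hhi hκ hκ₁ hu z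
  fin_cases i
  · have h := convex_univ.norm_image_sub_le_of_norm_hasDerivWithin_le (f := XE u)
      (fun z _ => (hasDerivAt_XE (hud z)).hasDerivWithinAt)
      (fun z _ => by rw [Real.norm_eq_abs]; exact (hb z).1) (mem_univ y) (mem_univ x)
    rw [Real.norm_eq_abs, Real.norm_eq_abs] at h; exact h
  · have h := convex_univ.norm_image_sub_le_of_norm_hasDerivWithin_le (f := YE u)
      (fun z _ => (hasDerivAt_YE (hud z)).hasDerivWithinAt)
      (fun z _ => by rw [Real.norm_eq_abs]; exact (hb z).2) (mem_univ y) (mem_univ x)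
    rw [Real.norm_eq_abs, Real.norm_eq_abs] at h; exact h

variable {μ Kc r₀ g₀ w : ℝ} (hG : GeomConstants (frameLevel μ K) Kc r₀ g₀ w) (hν : |ν - μ| < r₀)
include hG hν

/-- **Uniform window convexity**: at an angle where `2p(θ) − w⃗` is `ρ`-close to `2πm` and `|ν − μ| + Kc√2ρ < r₀`,
`G″(θ) ≥ c(ρ) := 2w·u_min² − ((w + Kc)·(γ·√2S_E/g₀)² + 2Kc·√2S_E·(γ·√2S_E/g₀) + γ·A_E)`, `γ = Kc√2ρ`, `S_E` the speed bound, `A_E = U₂ + 2U₁ + π√2` the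
acceleration bound (`abs_second_deriv_le_of_geomConstants`, `abs_deriv_le`). [cite: FeldmanSalmhoferTrubowitz1998, Lemma 2.1] -/
theorem transCurve_second_deriv_ge_on_window (θ : ℝ) (wv : Fin 2 → ℝ) (m : Fin 2 → ℤ) {ρ : ℝ}
    (hwin : ∀ i, |2 * (u θ • dir θ) i - wv i - m i * (2 * π)| ≤ ρ) (hνρ : |ν - μ| + Kc * (Real.sqrt 2 * ρ) < r₀) :
    2 * w * B.umin ^ 2 -
        ((w + Kc) * (Kc * (Real.sqrt 2 * ρ) * (Real.sqrt 2 * (B.smax + κ₁ * (π * Real.sqrt 2 + 2 * B.smax) / (B.Dtmin - κ₁))) / g₀) ^ 2 +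
          2 * Kc * (Real.sqrt 2 * (B.smax + κ₁ * (π * Real.sqrt 2 + 2 * B.smax) / (B.Dtmin - κ₁))) *
            (Kc * (Real.sqrt 2 * ρ) * (Real.sqrt 2 * (B.smax + κ₁ * (π * Real.sqrt 2 + 2 * B.smax) / (B.Dtmin - κ₁))) / g₀) +
          Kc * (Real.sqrt 2 * ρ) *
            ((2 * Kc * (B.smax + κ₁ * (π * Real.sqrt 2 + 2 * B.smax) / (B.Dtmin - κ₁)) ^ 2 +
                (8 + 2 * κ₁) * ((4 + κ₁) * (π * Real.sqrt 2) / (B.Dtmin - κ₁)) + (4 + κ₁) * (π * Real.sqrt 2)) / (B.Dtmin - κ₁) +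
              2 * ((4 + κ₁) * (π * Real.sqrt 2) / (B.Dtmin - κ₁)) + π * Real.sqrt 2)) ≤
      fderiv ℝ (fderiv ℝ (frameLevel μ K)) (WithLp.toLp 2 (u θ • dir θ - wv)) (WithLp.toLp 2 ![VXE u θ, VYE u θ])
          (WithLp.toLp 2 ![VXE u θ, VYE u θ]) +
        fderiv ℝ (frameLevel μ K) (WithLp.toLp 2 (u θ • dir θ - wv))
          (WithLp.toLp 2 ![deriv (deriv u) θ * Real.cos θ - 2 * deriv u θ * Real.sin θ - u θ * Real.cos θ,
            deriv (deriv u) θ * Real.sin θ + 2 * deriv u θ * Real.cos θ - u θ * Real.sin θ]) := by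
  set SE := B.smax + κ₁ * (π * Real.sqrt 2 + 2 * B.smax) / (B.Dtmin - κ₁) with hSE
  set U1 := (4 + κ₁) * (π * Real.sqrt 2) / (B.Dtmin - κ₁) with hU1
  set U2 := (2 * Kc * SE ^ 2 + (8 + 2 * κ₁) * U1 + (4 + κ₁) * (π * Real.sqrt 2)) / (B.Dtmin - κ₁) with hU2
  set γ := Kc * (Real.sqrt 2 * ρ) with hγ
  set S := ‖(WithLp.toLp 2 ![VXE u θ, VYE u θ] : Momentum)‖ with hS
  set A := ‖(WithLp.toLp 2 ![deriv (deriv u) θ * Real.cos θ - 2 * deriv u θ * Real.sin θ - u θ * Real.cos θ,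
    deriv (deriv u) θ * Real.sin θ + 2 * deriv u θ * Real.cos θ - u θ * Real.sin θ] : Momentum)‖ with hA
  have hmain := caustic_second_variation_frame_ge B hδ hlo hhi hκ hκ₁ hu hG hν θ wv m hwin hνρ
  rw [← hγ, ← hS, ← hA] at hmain
  -- sizes
  have hδs : ContDiff ℝ 2 (fun k : Fin 2 → ℝ => -K.eval k) := contDiff_frameShift_toLp K
  have h2ne : (2 : WithTop ℕ∞) ≠ 0 := by norm_num
  have hsq := abs_apply_le_pi_of_isBandFermiRadius (hu θ)
  have hden : 0 < B.Dtmin - κ₁ := sub_pos.2 hκ₁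
  have hKc : 0 ≤ Kc := le_trans (norm_nonneg _) (hG.norm_iteratedFDeriv_le (WithLp.toLp 2 (u θ • dir θ)) 0 (by norm_num))
  have hw : 0 < w := hG.wmin_pos
  have hg₀ : 0 < g₀ := hG.g₀_pos
  have hκ₁0 : 0 ≤ κ₁ := le_trans (norm_nonneg _) (hκ _ hsq)
  have hρ0 : 0 ≤ ρ := (abs_nonneg _).trans (hwin 0)
  have hγ0 : 0 ≤ γ := by rw [hγ]; positivity
  obtain ⟨hvx, hvy⟩ := abs_VXE_le B hδs h2ne hδ hlo hhi hκ hκ₁ hu θ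
  have hSE0 : 0 ≤ SE := (abs_nonneg _).trans hvx
  have hupos : 0 < u θ := (mem_Ioo_of_shifted B hδ hlo hhi (hu θ)).1
  have hule : u θ ≤ π * Real.sqrt 2 := root_le_pi_mul_sqrt_two B hδ hlo hhi hu θ
  have humin : B.umin ≤ u θ := umin_le_of_shifted B hδ hlo hhi (hu θ)
  -- `S ≤ √2 S_E`, `X_E′² + Y_E′² ≥ u_min²`
  have hS2 : S ^ 2 = VXE u θ ^ 2 + VYE u θ ^ 2 := by
    rw [hS, EuclideanSpace.norm_eq, Real.sq_sqrt (Finset.sum_nonneg fun i _ => sq_nonneg _), Fin.sum_univ_two]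
    simp only [Real.norm_eq_abs, sq_abs, Matrix.cons_val_zero, Matrix.cons_val_one]
  have hSle : S ≤ Real.sqrt 2 * SE := by
    have h1 : VXE u θ ^ 2 ≤ SE ^ 2 := by rw [← sq_abs]; exact pow_le_pow_left₀ (abs_nonneg _) hvx 2
    have h2 : VYE u θ ^ 2 ≤ SE ^ 2 := by rw [← sq_abs]; exact pow_le_pow_left₀ (abs_nonneg _) hvy 2
    have h3 : S ^ 2 ≤ (Real.sqrt 2 * SE) ^ 2 := by
      rw [hS2, mul_pow, Real.sq_sqrt (by norm_num : (0:ℝ) ≤ 2)]; linarith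
    exact (pow_le_pow_iff_left₀ (norm_nonneg _) (by positivity) two_ne_zero).1 h3
  have hS0 : 0 ≤ S := norm_nonneg _
  have hV2 : B.umin ^ 2 ≤ VXE u θ ^ 2 + VYE u θ ^ 2 := by
    rw [← deriv_sq_add_sq_eq_VXE]
    nlinarith [sq_nonneg (deriv u θ), B.umin_pos]
  -- `A ≤ U₂ + 2U₁ + π√2`
  have hu1 : |deriv u θ| ≤ U1 := by
    have h := abs_deriv_le B hδs h2ne hδ hlo hhi hκ hκ₁ hu θ
    refine h.trans ?_
    rw [hU1]
    refine div_le_div_of_nonneg_right ?_ hden.le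
    exact mul_le_mul_of_nonneg_left hule (by linarith only [hκ₁0])
  have hu2 : |deriv (deriv u) θ| ≤ U2 := abs_second_deriv_le_of_geomConstants B hδ hlo hhi hκ hκ₁ hu hG θ
  have hAle : A ≤ U2 + 2 * U1 + π * Real.sqrt 2 := by
    have h := norm_toLp_accel_le B hδ hlo hhi hu θ
    rw [← hA] at h
    linarith only [h, hu1, hu2, hule]
  have hA0 : 0 ≤ A := norm_nonneg _
  -- monotonicity of the error terms
  have e1 : (w + Kc) * (γ * S / g₀) ^ 2 ≤ (w + Kc) * (γ * (Real.sqrt 2 * SE) / g₀) ^ 2 := by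
    have h : γ * S / g₀ ≤ γ * (Real.sqrt 2 * SE) / g₀ := by
      refine div_le_div_of_nonneg_right ?_ hg₀.le; exact mul_le_mul_of_nonneg_left hSle hγ0
    have h0 : 0 ≤ γ * S / g₀ := by positivity
    have := pow_le_pow_left₀ h0 h 2
    exact mul_le_mul_of_nonneg_left this (by linarith)
  have e2 : 2 * Kc * S * (γ * S / g₀) ≤ 2 * Kc * (Real.sqrt 2 * SE) * (γ * (Real.sqrt 2 * SE) / g₀) := by
    have h : γ * S / g₀ ≤ γ * (Real.sqrt 2 * SE) / g₀ := by
      refine div_le_div_of_nonneg_right ?_ hg₀.le; exact mul_le_mul_of_nonneg_left hSle hγ0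
    have h0 : 0 ≤ γ * S / g₀ := by positivity
    calc 2 * Kc * S * (γ * S / g₀) ≤ 2 * Kc * (Real.sqrt 2 * SE) * (γ * S / g₀) := by
          refine mul_le_mul_of_nonneg_right ?_ h0; exact mul_le_mul_of_nonneg_left hSle (by positivity)
      _ ≤ 2 * Kc * (Real.sqrt 2 * SE) * (γ * (Real.sqrt 2 * SE) / g₀) := by
          refine mul_le_mul_of_nonneg_left h ?_; positivity
  have e3 : γ * A ≤ γ * (U2 + 2 * U1 + π * Real.sqrt 2) := mul_le_mul_of_nonneg_left hAle hγ0
  have e4 : 2 * w * B.umin ^ 2 ≤ 2 * w * (VXE u θ ^ 2 + VYE u θ ^ 2) := mul_le_mul_of_nonneg_left hV2 (by positivity)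
  linarith only [hmain, e1, e2, e3, e4]

/-! ## §3 The caustic window bound -/

omit hG hν in
/-- **The caustic window bound on the frame curve** (frame twin of `klsg_window_volume_le`).  `u` a `2π`-periodic root selection, `m ∈ ℤ²`, `δ > 0`,
`W = πρ₂/(√2 u_min) < 2π`; if `c > 0` bounds `G″` from below at every angle whose `2p(θ) − w⃗` is `(ρ₂ + 2S_E W)`-close to `2πm`
(`transCurve_second_deriv_ge_on_window`), then the points of a period with `|E(p(θ) − w⃗) − ν| ≤ δ` and `2p(θ) − w⃗` within `ρ₂` of `2πm` have measure
`≤ 3·6√(δ/c)` (three `c`-convex windows around any one such point; `klsc_volume_sublevel_le_of_convex_sqrt`). [cite: FeldmanSalmhoferTrubowitz1998, App. B] -/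
theorem window_volume_le_frame (hper : Function.Periodic u (2 * π)) (wv : Fin 2 → ℝ) (m : Fin 2 → ℤ) (θ₀ : ℝ) {δ ρ₂ c : ℝ}
    (hδ0 : 0 < δ) (hc : 0 < c) (hσ : ρ₂ / (Real.sqrt 2 * B.umin) < 2)
    (hcwin : ∀ θ : ℝ, (∀ i, |2 * (u θ • dir θ) i - wv i - m i * (2 * π)| ≤
        ρ₂ + 2 * (B.smax + κ₁ * (π * Real.sqrt 2 + 2 * B.smax) / (B.Dtmin - κ₁)) * (π * (ρ₂ / (Real.sqrt 2 * B.umin)))) →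
      c ≤ fderiv ℝ (fderiv ℝ (frameLevel μ K)) (WithLp.toLp 2 (u θ • dir θ - wv)) (WithLp.toLp 2 ![VXE u θ, VYE u θ])
          (WithLp.toLp 2 ![VXE u θ, VYE u θ]) +
        fderiv ℝ (frameLevel μ K) (WithLp.toLp 2 (u θ • dir θ - wv))
          (WithLp.toLp 2 ![deriv (deriv u) θ * Real.cos θ - 2 * deriv u θ * Real.sin θ - u θ * Real.cos θ,
            deriv (deriv u) θ * Real.sin θ + 2 * deriv u θ * Real.cos θ - u θ * Real.sin θ])) :
    volume {z ∈ Icc θ₀ (θ₀ + 2 * π) |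
        |sqDispersion (u z • dir z - wv) + -K.eval (u z • dir z - wv) - ν| ≤ δ ∧
          ∀ i, |2 * (u z • dir z) i - wv i - m i * (2 * π)| ≤ ρ₂} ≤
      3 * ENNReal.ofReal (6 * Real.sqrt (δ / c)) := by
  classical
  have hπ := Real.pi_pos
  have hup := B.umin_pos
  set SE := B.smax + κ₁ * (π * Real.sqrt 2 + 2 * B.smax) / (B.Dtmin - κ₁) with hSE
  set W := π * (ρ₂ / (Real.sqrt 2 * B.umin)) with hW
  set V := {z ∈ Icc θ₀ (θ₀ + 2 * π) |
      |sqDispersion (u z • dir z - wv) + -K.eval (u z • dir z - wv) - ν| ≤ δ ∧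
        ∀ i, |2 * (u z • dir z) i - wv i - m i * (2 * π)| ≤ ρ₂} with hV
  -- the level function and its derivatives
  set f := frameLevel μ K with hf
  set G : ℝ → ℝ := fun z => sqDispersion (u z • dir z - wv) + -K.eval (u z • dir z - wv) - ν with hG
  set G' : ℝ → ℝ := fun z => fderiv ℝ f (WithLp.toLp 2 (u z • dir z - wv)) (WithLp.toLp 2 ![VXE u z, VYE u z]) with hG'
  set G'' : ℝ → ℝ := fun z => fderiv ℝ (fderiv ℝ f) (WithLp.toLp 2 (u z • dir z - wv)) (WithLp.toLp 2 ![VXE u z, VYE u z])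
      (WithLp.toLp 2 ![VXE u z, VYE u z]) +
    fderiv ℝ f (WithLp.toLp 2 (u z • dir z - wv))
      (WithLp.toLp 2 ![deriv (deriv u) z * Real.cos z - 2 * deriv u z * Real.sin z - u z * Real.cos z,
        deriv (deriv u) z * Real.sin z + 2 * deriv u z * Real.cos z - u z * Real.sin z]) with hG''
  have hδs : ContDiff ℝ 2 (fun k : Fin 2 → ℝ => -K.eval k) := contDiff_frameShift_toLp K
  have h2ne : (2 : WithTop ℕ∞) ≠ 0 := by norm_num
  have hu2 : ContDiff ℝ 2 u := contDiff_of_isRoot B hδs h2ne hδ hlo hhi hκ hκ₁ hu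
  have hud : ∀ z, DifferentiableAt ℝ u z := fun z => (hu2.differentiable h2ne) z
  have hud' : ∀ z, DifferentiableAt ℝ (deriv u) z := fun z => by
    have h2 : ContDiff ℝ ((1 : WithTop ℕ∞) + 1) u := by rw [one_add_one_eq_two]; exact hu2
    have h : ContDiff ℝ 1 (deriv u) := (contDiff_succ_iff_deriv.1 h2).2.2
    exact (h.differentiable one_ne_zero) z
  have hGfun : G = fun z => f (WithLp.toLp 2 (u z • dir z - wv)) + (μ - ν) := by
    funext z
    simp only [hG, hf, frameLevel_toLp, frameShift_toLp]
    ring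
  have hGd : ∀ t, HasDerivAt G (G' t) t := fun t => by
    rw [hGfun]
    exact (hasDerivAt_frameLevel_transCurve μ K (hud t) wv).add_const (μ - ν)
  have hG'd : ∀ t, HasDerivAt G' (G'' t) t := fun t => hasDerivAt_fderiv_frameLevel_transCurve μ K (hud t) (hud' t) wv
  -- periodicity of the curve
  have hcurve_per : ∀ (z : ℝ) (k : ℤ), u (z + k * (2 * π)) • dir (z + k * (2 * π)) = u z • dir z := by
    intro z k
    have h1 : u (z + k * (2 * π)) = u z := hper.int_mul k z
    have h2 : dir (z + k * (2 * π)) = dir z := by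
      ext i; fin_cases i
      · simp [dir, Real.cos_add_int_mul_two_pi]
      · simp [dir, Real.sin_add_int_mul_two_pi]
    rw [h1, h2]
  by_cases hex : ∃ ζ, ζ ∈ V
  · obtain ⟨ζ, hζP, -, hζw⟩ := hex
    -- windows around `ζ + 2πk`
    have hwin : ∀ k : ℤ, ∀ θ ∈ Icc (ζ + k * (2 * π) - W) (ζ + k * (2 * π) + W),
        ∀ i, |2 * (u θ • dir θ) i - wv i - m i * (2 * π)| ≤ ρ₂ + 2 * SE * W := by
      intro k θ hθ i
      have hL := abs_curve_sub_le_frame B hδ hlo hhi hκ hκ₁ hu θ (ζ + k * (2 * π)) i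
      rw [hcurve_per ζ k] at hL
      have hdist : |θ - (ζ + k * (2 * π))| ≤ W := by rw [abs_le]; constructor <;> linarith [hθ.1, hθ.2]
      have hSE0 : 0 ≤ SE := by
        have h0 := abs_curve_sub_le_frame B hδ hlo hhi hκ hκ₁ hu (ζ + 1) ζ 0
        rw [show ζ + 1 - ζ = (1 : ℝ) by ring, abs_one, mul_one] at h0
        exact (abs_nonneg _).trans h0
      have hL' : |(u θ • dir θ) i - (u ζ • dir ζ) i| ≤ SE * W := hL.trans (mul_le_mul_of_nonneg_left hdist hSE0)
      have hζi := hζw i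
      obtain ⟨a1, a2⟩ := abs_le.1 hL'
      obtain ⟨b1, b2⟩ := abs_le.1 hζi
      rw [abs_le]; constructor <;> linarith
    have hconvk : ∀ k : ℤ, ∀ t ∈ Icc (ζ + k * (2 * π) - W) (ζ + k * (2 * π) + W), c ≤ G'' t :=
      fun k t ht => hcwin t (hwin k t ht)
    have hvolk : ∀ k : ℤ, volume {z ∈ Icc (ζ + k * (2 * π) - W) (ζ + k * (2 * π) + W) | |G z| ≤ δ} ≤
        ENNReal.ofReal (6 * Real.sqrt (δ / c)) :=
      fun k => klsc_volume_sublevel_le_of_convex_sqrt hGd hG'd hc hδ0 (hconvk k)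
    -- `V` is covered by the three windows `k = -1, 0, 1`
    have hcover : V ⊆ {z ∈ Icc (ζ + (-1 : ℤ) * (2 * π) - W) (ζ + (-1 : ℤ) * (2 * π) + W) | |G z| ≤ δ} ∪
        {z ∈ Icc (ζ + (0 : ℤ) * (2 * π) - W) (ζ + (0 : ℤ) * (2 * π) + W) | |G z| ≤ δ} ∪
        {z ∈ Icc (ζ + (1 : ℤ) * (2 * π) - W) (ζ + (1 : ℤ) * (2 * π) + W) | |G z| ≤ δ} := by
      intro z hz
      obtain ⟨hzP, hGz, hzw⟩ := hz
      have hclose : ∀ i : Fin 2, |(u z • dir z) i - (u ζ • dir ζ) i| ≤ ρ₂ := by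
        intro i
        obtain ⟨a1, a2⟩ := abs_le.1 (hzw i)
        obtain ⟨b1, b2⟩ := abs_le.1 (hζw i)
        rw [abs_le]; constructor <;> linarith
      obtain ⟨k, hk⟩ := exists_int_near_of_close_frame B hδ hlo hhi hu hclose
      have hWlt : W < 2 * π := by rw [hW]; nlinarith [hσ, hπ]
      have hzζ : |z - ζ| ≤ 2 * π := by
        rw [abs_le]; constructor <;> linarith [hzP.1, hzP.2, hζP.1, hζP.2]
      have hkabs : |(k : ℝ)| < 2 := by
        have h3 : |(k : ℝ) * (2 * π)| ≤ |z - ζ| + W := by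
          have e : (k : ℝ) * (2 * π) = (z - ζ) - (z - ζ - k * (2 * π)) := by ring
          calc |(k : ℝ) * (2 * π)| = |(z - ζ) - (z - ζ - k * (2 * π))| := by rw [← e]
            _ ≤ |z - ζ| + |z - ζ - k * (2 * π)| := abs_sub _ _
            _ ≤ |z - ζ| + W := by linarith [hk]
        rw [abs_mul, abs_of_pos (by positivity : (0:ℝ) < 2 * π)] at h3
        have h4 : |(k : ℝ)| * (2 * π) < 2 * (2 * π) := by linarith
        exact lt_of_mul_lt_mul_right h4 (by positivity)
      have hk2 : -2 < k ∧ k < 2 := by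
        rw [abs_lt] at hkabs
        exact ⟨by exact_mod_cast hkabs.1, by exact_mod_cast hkabs.2⟩
      have hzI : z ∈ Icc (ζ + k * (2 * π) - W) (ζ + k * (2 * π) + W) := by
        rw [abs_le] at hk; constructor <;> linarith [hk.1, hk.2]
      have hGz' : |G z| ≤ δ := hGz
      rcases hk2 with ⟨hk1, hk3⟩
      interval_cases k
      · exact Or.inl (Or.inl ⟨by simpa using hzI, hGz'⟩)
      · exact Or.inl (Or.inr ⟨by simpa using hzI, hGz'⟩)
      · exact Or.inr ⟨by simpa using hzI, hGz'⟩
    calc volume V ≤ volume ({z ∈ Icc (ζ + (-1 : ℤ) * (2 * π) - W) (ζ + (-1 : ℤ) * (2 * π) + W) | |G z| ≤ δ} ∪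
          {z ∈ Icc (ζ + (0 : ℤ) * (2 * π) - W) (ζ + (0 : ℤ) * (2 * π) + W) | |G z| ≤ δ} ∪
          {z ∈ Icc (ζ + (1 : ℤ) * (2 * π) - W) (ζ + (1 : ℤ) * (2 * π) + W) | |G z| ≤ δ}) :=
          measure_mono hcover
      _ ≤ volume ({z ∈ Icc (ζ + (-1 : ℤ) * (2 * π) - W) (ζ + (-1 : ℤ) * (2 * π) + W) | |G z| ≤ δ} ∪
          {z ∈ Icc (ζ + (0 : ℤ) * (2 * π) - W) (ζ + (0 : ℤ) * (2 * π) + W) | |G z| ≤ δ}) +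
          volume {z ∈ Icc (ζ + (1 : ℤ) * (2 * π) - W) (ζ + (1 : ℤ) * (2 * π) + W) | |G z| ≤ δ} :=
          measure_union_le _ _
      _ ≤ (volume {z ∈ Icc (ζ + (-1 : ℤ) * (2 * π) - W) (ζ + (-1 : ℤ) * (2 * π) + W) | |G z| ≤ δ} +
          volume {z ∈ Icc (ζ + (0 : ℤ) * (2 * π) - W) (ζ + (0 : ℤ) * (2 * π) + W) | |G z| ≤ δ}) +
          volume {z ∈ Icc (ζ + (1 : ℤ) * (2 * π) - W) (ζ + (1 : ℤ) * (2 * π) + W) | |G z| ≤ δ} := by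
          gcongr; exact measure_union_le _ _
      _ ≤ (ENNReal.ofReal (6 * Real.sqrt (δ / c)) + ENNReal.ofReal (6 * Real.sqrt (δ / c))) +
          ENNReal.ofReal (6 * Real.sqrt (δ / c)) := by
          gcongr
          · exact hvolk (-1)
          · exact hvolk 0
          · exact hvolk 1
      _ = 3 * ENNReal.ofReal (6 * Real.sqrt (δ / c)) := by ring
  · have hV0 : V = ∅ := Set.eq_empty_iff_forall_notMem.2 fun z hz => hex ⟨z, hz⟩
    rw [hV0, measure_empty]
    exact bot_le

end Root

end Summit.HubbardSuperconductivity.HubbardSuperconductivity.Theorems.PerturbedFermiCurve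

end
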